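import Summits.AtomisticToContinuum.Crystallization.Theses.PeriodicChargeSplit

/-!
# PeriodicChargeSplit · assembly item (stmt-AtomisticToContinuum-26656), BY NAME

The route's gate-written deciding theorem `PeriodicChargeSplit.closes` curried: `NonTcpCentreCase → PeriodicMinimiserCharge →
NoFrustratedPeriodicMinimiser → AperiodicFrustratedLawGap → Crystallization` is literally the assembly decl `PeriodicChargeSplit.Assembly`
(pattern of `GrainCoreNetworkSplitAssembly` / `GappedShellCensusAssembly`; nothing analytic).  Landed by hand 2 of the decomp-a2c cell
(generation 5) together with the door-free surgery-currency reductions of D = `NoFrustratedPeriodicMinimiser`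
(`FrustratedLawDichotomyPeriodicChargeSplitGSCDoor`) and of the parent piece Φper (`FrustratedLawDichotomyPeriodicGapChargeDoor`).  `[folklore]`.
-/

namespace Summit.AtomisticToContinuum.Crystallization.Theorems.PeriodicChargeSplitAssembly

open Summit.AtomisticToContinuum.Crystallization.Theses.PeriodicChargeSplit

/-- **Assembly of route PeriodicChargeSplit** (item stmt-AtomisticToContinuum-26656): the four pieces give `Crystallization`, by the route's
deciding theorem `closes`. [folklore] -/
theorem periodicChargeSplit_assembly : Summit.AtomisticToContinuum.Crystallization.Theses.PeriodicChargeSplit.Assembly :=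
  fun h₁ h₂ h₃ h₄ => closes h₁ h₂ h₃ h₄

end Summit.AtomisticToContinuum.Crystallization.Theorems.PeriodicChargeSplitAssembly
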